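import Summits.ValiantsHypothesis.ValiantsHypothesis.Theorems.LacunarySymmetroidMatrixDescartesFiniteSectorSumMasksHigher

/-!
# `MatrixDescartes` — line «finite»: the SECTOR CEILING `η(3,5) ≤ σ(3,5) = 48` (kernel) — `HypRootLawAt 3 5 48`, Conjecture Σ's value
# `2·n(3,4)` at the cell `(3,5)`

HONEST FRAMING.  Object-search cell `pub-symmetroid`, seat val-sym-door-p5 g8.  HELPER of the crux item `stmt-ValiantsHypothesis-18050`
(`Theses.LacunarySymmetroid.MatrixDescartes`) with NO closure claim.  Same method as `…FiniteSectorSectorCeilingThreeFour` (p615386, `σ(3,4) = 30`): the SIEVE of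
line «finite» (`FiniteSector.sieve`, `natDegree_mem_sumset`) makes the `3`-fold sums of exponents of an in-sector pencil a step-≤-2 chain from `0` up to the
degree; the finite core — no `4` positive values carry such a chain beyond `48` — is a pruned nested enumeration ({nodes} live prefixes) decided in the kernel
with the `3`-fold sum set carried as an iterated shift-form BITMASK (`…FiniteSectorSumMasksHigher`).  Result: `hypRootLawAt_three_five_48 : HypRootLawAt 3 5 48`.  Located first
(exact DFS, this seat, HOME/val-sym-door-p5/g8/work/mask/psenum_m.py): the chain survives to `47` only on {finals}, where `49` is not an `3`-fold sum and `48`, `50`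
are not both — `σ(3,5) = 48 = 2·n(3,4)`, Conjecture Σ of `Lines/finite.md` at the cell `(3,5)`; the lower side needs a realised doubled basis and is NOT
claimed here.  Nothing here bears on the crux (asymptotic), on `H3`, on the doors, or on `VP ≠ VNP`.
[folklore] Gap-rule / sieve bookkeeping plus a finite enumeration (postage-stamp numbers `n(3,·)`); no citation is load-bearing.
-/

-- `Summit.ValiantsHypothesis.ValiantsHypothesis.…` repeats a component by the D-0017 layout
-- (single-conjunct summit), which the `dupNamespace` linter flags; the name is mandated.
set_option linter.dupNamespace false

namespace Summit.ValiantsHypothesis.ValiantsHypothesis.Theorems.LacunarySymmetroidMatrixDescartes.FiniteSector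

open scoped BigOperators Matrix
open Polynomial

/-! ## `(3,5)`: `σ(3,5) = 48` -/

set_option synthInstance.maxSize 2000000 in
set_option synthInstance.maxHeartbeats 2000000 in
set_option maxHeartbeats 4000000 in
/-- **Finite core of `σ(3,5) = 48`** (pruned nested enumeration over sorted positive values `< 52`, `3`-fold sums as bitmasks, `decide` in the
kernel): prefix chains alive below the next value and the whole chain reaching `47` force `49` NOT an `3`-fold sum and `48`, `50` not BOTH. [folklore] -/
theorem sectorCheck_three_five :
    ∀ a ∈ List.range 52, (0 < a ∧ ((List.foldr (fun x acc => acc ||| (List.foldr (fun x acc => acc ||| (List.foldr (fun y acc => acc ||| 2 ^ y) 0 [0]) * 2 ^ x) 0 [0]) * 2 ^ x) 0 [0] ||| List.foldr (fun x acc => acc ||| (List.foldr (fun x acc => acc ||| (List.foldr (fun y acc => acc ||| 2 ^ y) 0 [0]) * 2 ^ x) 0 [0]) * 2 ^ x) 0 [0] / 2) % 2 ^ (min 48 (a - 1)) = 2 ^ (min 48 (a - 1)) - 1)) →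
    ∀ b ∈ List.range 52, (a < b ∧ ((List.foldr (fun x acc => acc ||| (List.foldr (fun x acc => acc ||| (List.foldr (fun y acc => acc ||| 2 ^ y) 0 [0, a]) * 2 ^ x) 0 [0, a]) * 2 ^ x) 0 [0, a] ||| List.foldr (fun x acc => acc ||| (List.foldr (fun x acc => acc ||| (List.foldr (fun y acc => acc ||| 2 ^ y) 0 [0, a]) * 2 ^ x) 0 [0, a]) * 2 ^ x) 0 [0, a] / 2) % 2 ^ (min 48 (b - 1)) = 2 ^ (min 48 (b - 1)) - 1)) →
    ∀ c ∈ List.range 52, (b < c ∧ ((List.foldr (fun x acc => acc ||| (List.foldr (fun x acc => acc ||| (List.foldr (fun y acc => acc ||| 2 ^ y) 0 [0, a, b]) * 2 ^ x) 0 [0, a, b]) * 2 ^ x) 0 [0, a, b] ||| List.foldr (fun x acc => acc ||| (List.foldr (fun x acc => acc ||| (List.foldr (fun y acc => acc ||| 2 ^ y) 0 [0, a, b]) * 2 ^ x) 0 [0, a, b]) * 2 ^ x) 0 [0, a, b] / 2) % 2 ^ (min 48 (c - 1)) = 2 ^ (min 48 (c - 1)) - 1)) →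
    ∀ e ∈ List.range 52, (c < e ∧ ((List.foldr (fun x acc => acc ||| (List.foldr (fun x acc => acc ||| (List.foldr (fun y acc => acc ||| 2 ^ y) 0 [0, a, b, c]) * 2 ^ x) 0 [0, a, b, c]) * 2 ^ x) 0 [0, a, b, c] ||| List.foldr (fun x acc => acc ||| (List.foldr (fun x acc => acc ||| (List.foldr (fun y acc => acc ||| 2 ^ y) 0 [0, a, b, c]) * 2 ^ x) 0 [0, a, b, c]) * 2 ^ x) 0 [0, a, b, c] / 2) % 2 ^ (min 48 (e - 1)) = 2 ^ (min 48 (e - 1)) - 1)) →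
    (((List.foldr (fun x acc => acc ||| (List.foldr (fun x acc => acc ||| (List.foldr (fun y acc => acc ||| 2 ^ y) 0 [0, a, b, c, e]) * 2 ^ x) 0 [0, a, b, c, e]) * 2 ^ x) 0 [0, a, b, c, e] ||| List.foldr (fun x acc => acc ||| (List.foldr (fun x acc => acc ||| (List.foldr (fun y acc => acc ||| 2 ^ y) 0 [0, a, b, c, e]) * 2 ^ x) 0 [0, a, b, c, e]) * 2 ^ x) 0 [0, a, b, c, e] / 2) % 2 ^ 48 = 2 ^ 48 - 1) →
      ((List.foldr (fun x acc => acc ||| (List.foldr (fun x acc => acc ||| (List.foldr (fun y acc => acc ||| 2 ^ y) 0 [0, a, b, c, e]) * 2 ^ x) 0 [0, a, b, c, e]) * 2 ^ x) 0 [0, a, b, c, e]).testBit 49 = false ∧ ((List.foldr (fun x acc => acc ||| (List.foldr (fun x acc => acc ||| (List.foldr (fun y acc => acc ||| 2 ^ y) 0 [0, a, b, c, e]) * 2 ^ x) 0 [0, a, b, c, e]) * 2 ^ x) 0 [0, a, b, c, e]).testBit 48 = false ∨ (List.foldr (fun x acc => acc ||| (List.foldr (fun x acc => acc ||| (List.foldr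 (fun y acc => acc ||| 2 ^ y) 0 [0, a, b, c, e]) * 2 ^ x) 0 [0, a, b, c, e]) * 2 ^ x) 0 [0, a, b, c, e]).testBit 50 = false))) := by
  decide +kernel

/-- **`η(3,5) ≤ 48 = σ(3,5)`** — `HypRootLawAt 3 5 48`: every in-sector (`#distinct real roots = natDegree`) determinant of a real symmetric
`3 × 3` lacunary pencil with `5` terms has degree `≤ 48` (SIEVE ⇒ `3`-fold-sum chain; values capped at `51`, padded, sorted; prefix pruning; masks;
`sectorCheck_three_five`). [folklore] -/
theorem hypRootLawAt_three_five_48 : HypRootLawAt 3 5 48 := by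
  intro d S hS hsec
  by_contra hdeg'
  have hdeg : 48 < (pencil d S).det.natDegree := not_le.mp hdeg'
  have hq : (pencil d S).det ≠ 0 := by
    intro h0
    rw [h0] at hdeg
    simp at hdeg
  have hpair : ∀ r, r ∈ (Finset.univ : Finset (Sym (Fin 5) 3)).image
      (fun s : Sym (Fin 5) 3 => ((s : Multiset (Fin 5)).map d).sum) → ∃ i j k : Fin 5, d i + d j + d k = r := by
    intro r hr
    rw [Finset.mem_image] at hr
    obtain ⟨s, -, hs⟩ := hr
    have hcard : Multiset.card (s : Multiset (Fin 5)) = 3 := s.2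
    obtain ⟨i, j, k, hijk⟩ := Multiset.card_eq_three.mp hcard
    refine ⟨i, j, k, ?_⟩
    have hsum : ((s : Multiset (Fin 5)).map d).sum = d i + d j + d k := by
      rw [hijk]
      simp [add_assoc]
    omega
  have hchain : ∀ r, r + 2 ≤ (pencil d S).det.natDegree →
      (∃ i j k : Fin 5, d i + d j + d k = r) ∨ (∃ i j k : Fin 5, d i + d j + d k = r + 1) := by
    intro r hr
    rcases sieve d S hq hsec hr with h | h
    · exact Or.inl (hpair _ h)
    · exact Or.inr (hpair _ h)
  have htop : ∃ i j k : Fin 5, d i + d j + d k = (pencil d S).det.natDegree := hpair _ (natDegree_mem_sumset d S hq)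
  set cv : Fin 5 → ℕ := fun i => min (d i) 51 with hcv
  have hcvd : ∀ i, d i ≤ 50 → cv i = d i := fun i hi => by
    simp only [hcv]
    exact Nat.min_eq_left (by omega)
  have hcvle : ∀ i, cv i ≤ 51 := fun i => Nat.min_le_right _ _
  set V : Finset ℕ := Finset.univ.image cv with hV
  have hcvV : ∀ i, cv i ∈ V := fun i => Finset.mem_image_of_mem cv (Finset.mem_univ i)
  have h0V : 0 ∈ V := by
    have key : ∃ i : Fin 5, d i = 0 := by
      rcases hchain 0 (by omega) with ⟨i, j, k, hh⟩ | ⟨i, j, k, hh⟩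
      · exact ⟨i, by omega⟩
      · rcases Nat.eq_zero_or_pos (d i) with hi | hi
        · exact ⟨i, hi⟩
        · exact ⟨j, by omega⟩
    obtain ⟨i, hi⟩ := key
    have : cv i = 0 := by rw [hcvd i (by omega)]; omega
    exact this ▸ hcvV i
  set W : Finset ℕ := V.erase 0 with hW
  have hWsub : W ⊆ (Finset.range 52).erase 0 := by
    intro u hu
    rw [hW, Finset.mem_erase] at hu
    obtain ⟨hu0, huV⟩ := hu
    rw [hV, Finset.mem_image] at huV
    obtain ⟨i, -, rfl⟩ := huV
    rw [Finset.mem_erase, Finset.mem_range]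
    exact ⟨hu0, Nat.lt_succ_of_le (hcvle i)⟩
  have hWcard : W.card ≤ 4 := by
    have hVK : V.card ≤ 5 := by
      have := Finset.card_image_le (s := (Finset.univ : Finset (Fin 5))) (f := cv)
      simpa using this
    have h1 : W.card + 1 = V.card := by rw [hW]; exact Finset.card_erase_add_one h0V
    omega
  obtain ⟨W', hWW', hW'sub, hW'card⟩ := Finset.exists_subsuperset_card_eq hWsub hWcard
    (by rw [Finset.card_erase_of_mem (by simp), Finset.card_range]; omega)
  have hVW' : ∀ u ∈ V, u = 0 ∨ u ∈ W' := by
    intro u hu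
    by_cases hu0 : u = 0
    · exact Or.inl hu0
    · exact Or.inr (hWW' (by rw [hW, Finset.mem_erase]; exact ⟨hu0, hu⟩))
  have hlmem : ∀ u, u ∈ Finset.sort W' ↔ u ∈ W' := fun u => Finset.mem_sort _
  have hlsort : (Finset.sort W').SortedLT := Finset.sortedLT_sort W'
  have hllen : (Finset.sort W').length = 4 := by rw [Finset.length_sort, hW'card]
  generalize hl : Finset.sort W' = l at hlmem hlsort hllen
  rcases l with _ | ⟨a, _ | ⟨b, _ | ⟨c, _ | ⟨e, _ | ⟨zz, ll⟩⟩⟩⟩⟩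
  all_goals simp only [List.length_cons, List.length_nil] at hllen
  all_goals try omega
  have hmemR : ∀ u, u ∈ [a, b, c, e] → u ∈ List.range 52 := by
    intro u hu
    have hu' : u ∈ W' := (hlmem u).mp hu
    have := hW'sub hu'
    rw [Finset.mem_erase, Finset.mem_range] at this
    exact List.mem_range.mpr this.2
  have hne0 : ∀ u, u ∈ [a, b, c, e] → u ≠ 0 := by
    intro u hu
    have hu' : u ∈ W' := (hlmem u).mp hu
    have := hW'sub hu'
    rw [Finset.mem_erase] at this
    exact this.1
  have h0 : 0 < a := Nat.pos_of_ne_zero (hne0 a (by simp))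
  have hmemP : ∀ r, r ≤ 50 → (∃ i j k : Fin 5, d i + d j + d k = r) → (∃ x ∈ [0, a, b, c, e], ∃ y ∈ [0, a, b, c, e], ∃ z ∈ [0, a, b, c, e], x + y + z = r) := by
    rintro r hr ⟨i, j, k, hsum⟩
    have hi : cv i = d i := hcvd i (by omega)
    have hj : cv j = d j := hcvd j (by omega)
    have hk : cv k = d k := hcvd k (by omega)
    have hin : ∀ u ∈ V, u ∈ [0, a, b, c, e] := by
      intro u hu
      rcases hVW' u hu with h | h
      · rw [h]; simp
      · exact List.mem_cons_of_mem _ ((hlmem u).mpr h)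
    exact ⟨cv i, hin _ (hcvV i), cv j, hin _ (hcvV j), cv k, hin _ (hcvV k), by rw [hi, hj, hk]; exact hsum⟩
  have hchainP : ∀ r, r ≤ 47 → (∃ x ∈ [0, a, b, c, e], ∃ y ∈ [0, a, b, c, e], ∃ z ∈ [0, a, b, c, e], x + y + z = r) ∨ (∃ x ∈ [0, a, b, c, e], ∃ y ∈ [0, a, b, c, e], ∃ z ∈ [0, a, b, c, e], x + y + z = r + 1) := by
    intro r hr
    rcases hchain r (by omega) with h | h
    · exact Or.inl (hmemP r (by omega) h)
    · exact Or.inr (hmemP (r + 1) (by omega) h)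
  have hfull : ((List.foldr (fun x acc => acc ||| (List.foldr (fun x acc => acc ||| (List.foldr (fun y acc => acc ||| 2 ^ y) 0 [0, a, b, c, e]) * 2 ^ x) 0 [0, a, b, c, e]) * 2 ^ x) 0 [0, a, b, c, e] ||| List.foldr (fun x acc => acc ||| (List.foldr (fun x acc => acc ||| (List.foldr (fun y acc => acc ||| 2 ^ y) 0 [0, a, b, c, e]) * 2 ^ x) 0 [0, a, b, c, e]) * 2 ^ x) 0 [0, a, b, c, e] / 2) % 2 ^ 48 = 2 ^ 48 - 1) := by
    apply maskAlive_of_testBit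
    intro r hr
    rcases hchainP r (by omega) with h | h
    · exact Or.inl (testBit_fold3Shift_of_mem h)
    · exact Or.inr (testBit_fold3Shift_of_mem h)
  have hlt1 : a < b := by
    have := hlsort (show (⟨0, by simp⟩ : Fin [a, b, c, e].length) < ⟨1, by simp⟩ from Fin.mk_lt_mk.mpr (by norm_num))
    simpa using this
  have hlt2 : b < c := by
    have := hlsort (show (⟨1, by simp⟩ : Fin [a, b, c, e].length) < ⟨2, by simp⟩ from Fin.mk_lt_mk.mpr (by norm_num))
    simpa using this
  have hlt3 : c < e := by
    have := hlsort (show (⟨2, by simp⟩ : Fin [a, b, c, e].length) < ⟨3, by simp⟩ from Fin.mk_lt_mk.mpr (by norm_num))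
    simpa using this
  have pre1 : ((List.foldr (fun x acc => acc ||| (List.foldr (fun x acc => acc ||| (List.foldr (fun y acc => acc ||| 2 ^ y) 0 [0]) * 2 ^ x) 0 [0]) * 2 ^ x) 0 [0] ||| List.foldr (fun x acc => acc ||| (List.foldr (fun x acc => acc ||| (List.foldr (fun y acc => acc ||| 2 ^ y) 0 [0]) * 2 ^ x) 0 [0]) * 2 ^ x) 0 [0] / 2) % 2 ^ (min 48 (a - 1)) = 2 ^ (min 48 (a - 1)) - 1) := by
    apply maskAlive_of_testBit
    intro r hr
    have hrT : r < 48 := lt_of_lt_of_le hr (min_le_left _ _)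
    have hrv : r < a - 1 := lt_of_lt_of_le hr (min_le_right _ _)
    have hr' : r + 1 < a := by omega
    have hrest : ∀ y ∈ [a, b, c, e], a ≤ y := by
      intro y hy
      simp only [List.mem_cons, List.mem_nil_iff, or_false] at hy
      omega
    rcases hchainP r (by omega) with h | h
    · exact Or.inl (testBit_fold3Shift_of_mem (memP3_prefix (l₁ := [0]) (l₂ := [a, b, c, e]) hrest (by omega) h))
    · exact Or.inr (testBit_fold3Shift_of_mem (memP3_prefix (l₁ := [0]) (l₂ := [a, b, c, e]) hrest hr' h))
  have pre2 : ((List.foldr (fun x acc => acc ||| (List.foldr (fun x acc => acc ||| (List.foldr (fun y acc => acc ||| 2 ^ y) 0 [0, a]) * 2 ^ x) 0 [0, a]) * 2 ^ x) 0 [0, a] ||| List.foldr (fun x acc => acc ||| (List.foldr (fun x acc => acc ||| (List.foldr (fun y acc => acc ||| 2 ^ y) 0 [0, a]) * 2 ^ x) 0 [0, a]) * 2 ^ x) 0 [0, a] / 2) % 2 ^ (min 48 (b - 1)) = 2 ^ (min 48 (b - 1)) - 1) := by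
    apply maskAlive_of_testBit
    intro r hr
    have hrT : r < 48 := lt_of_lt_of_le hr (min_le_left _ _)
    have hrv : r < b - 1 := lt_of_lt_of_le hr (min_le_right _ _)
    have hr' : r + 1 < b := by omega
    have hrest : ∀ y ∈ [b, c, e], b ≤ y := by
      intro y hy
      simp only [List.mem_cons, List.mem_nil_iff, or_false] at hy
      omega
    rcases hchainP r (by omega) with h | h
    · exact Or.inl (testBit_fold3Shift_of_mem (memP3_prefix (l₁ := [0, a]) (l₂ := [b, c, e]) hrest (by omega) h))
    · exact Or.inr (testBit_fold3Shift_of_mem (memP3_prefix (l₁ := [0, a]) (l₂ := [b, c, e]) hrest hr' h))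
  have pre3 : ((List.foldr (fun x acc => acc ||| (List.foldr (fun x acc => acc ||| (List.foldr (fun y acc => acc ||| 2 ^ y) 0 [0, a, b]) * 2 ^ x) 0 [0, a, b]) * 2 ^ x) 0 [0, a, b] ||| List.foldr (fun x acc => acc ||| (List.foldr (fun x acc => acc ||| (List.foldr (fun y acc => acc ||| 2 ^ y) 0 [0, a, b]) * 2 ^ x) 0 [0, a, b]) * 2 ^ x) 0 [0, a, b] / 2) % 2 ^ (min 48 (c - 1)) = 2 ^ (min 48 (c - 1)) - 1) := by
    apply maskAlive_of_testBit
    intro r hr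
    have hrT : r < 48 := lt_of_lt_of_le hr (min_le_left _ _)
    have hrv : r < c - 1 := lt_of_lt_of_le hr (min_le_right _ _)
    have hr' : r + 1 < c := by omega
    have hrest : ∀ y ∈ [c, e], c ≤ y := by
      intro y hy
      simp only [List.mem_cons, List.mem_nil_iff, or_false] at hy
      omega
    rcases hchainP r (by omega) with h | h
    · exact Or.inl (testBit_fold3Shift_of_mem (memP3_prefix (l₁ := [0, a, b]) (l₂ := [c, e]) hrest (by omega) h))
    · exact Or.inr (testBit_fold3Shift_of_mem (memP3_prefix (l₁ := [0, a, b]) (l₂ := [c, e]) hrest hr' h))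
  have pre4 : ((List.foldr (fun x acc => acc ||| (List.foldr (fun x acc => acc ||| (List.foldr (fun y acc => acc ||| 2 ^ y) 0 [0, a, b, c]) * 2 ^ x) 0 [0, a, b, c]) * 2 ^ x) 0 [0, a, b, c] ||| List.foldr (fun x acc => acc ||| (List.foldr (fun x acc => acc ||| (List.foldr (fun y acc => acc ||| 2 ^ y) 0 [0, a, b, c]) * 2 ^ x) 0 [0, a, b, c]) * 2 ^ x) 0 [0, a, b, c] / 2) % 2 ^ (min 48 (e - 1)) = 2 ^ (min 48 (e - 1)) - 1) := by
    apply maskAlive_of_testBit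
    intro r hr
    have hrT : r < 48 := lt_of_lt_of_le hr (min_le_left _ _)
    have hrv : r < e - 1 := lt_of_lt_of_le hr (min_le_right _ _)
    have hr' : r + 1 < e := by omega
    have hrest : ∀ y ∈ [e], e ≤ y := by
      intro y hy
      simp only [List.mem_cons, List.mem_nil_iff, or_false] at hy
      omega
    rcases hchainP r (by omega) with h | h
    · exact Or.inl (testBit_fold3Shift_of_mem (memP3_prefix (l₁ := [0, a, b, c]) (l₂ := [e]) hrest (by omega) h))
    · exact Or.inr (testBit_fold3Shift_of_mem (memP3_prefix (l₁ := [0, a, b, c]) (l₂ := [e]) hrest hr' h))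
  obtain ⟨hnoT1, hnoT0T2⟩ := sectorCheck_three_five a (hmemR a (by simp)) ⟨h0, pre1⟩ b (hmemR b (by simp)) ⟨hlt1, pre2⟩ c (hmemR c (by simp)) ⟨hlt2, pre3⟩ e (hmemR e (by simp)) ⟨hlt3, pre4⟩ hfull
  have hcontra : ∀ r, r ≤ 50 → (∃ i j k : Fin 5, d i + d j + d k = r) → (List.foldr (fun x acc => acc ||| (List.foldr (fun x acc => acc ||| (List.foldr (fun y acc => acc ||| 2 ^ y) 0 [0, a, b, c, e]) * 2 ^ x) 0 [0, a, b, c, e]) * 2 ^ x) 0 [0, a, b, c, e]).testBit r = false → False := by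
    intro r hr h hf
    have hb := testBit_fold3Shift_of_mem (hmemP r hr h)
    rw [hf] at hb
    exact Bool.false_ne_true hb
  rcases Nat.lt_or_ge (pencil d S).det.natDegree 51 with hsmall | hbig
  · interval_cases h : (pencil d S).det.natDegree
    · exact hcontra 49 (by omega) htop hnoT1
    · rcases hchain 48 (by omega) with h' | h'
      · rcases hnoT0T2 with hf | hf
        · exact hcontra 48 (by omega) h' hf
        · exact hcontra 50 (by omega) htop hf
      · exact hcontra 49 (by omega) h' hnoT1
  · rcases hchain 48 (by omega) with h1 | h1
    · rcases hchain 49 (by omega) with h2 | h2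
      · exact hcontra 49 (by omega) h2 hnoT1
      · rcases hnoT0T2 with hf | hf
        · exact hcontra 48 (by omega) h1 hf
        · exact hcontra 50 (by omega) h2 hf
    · exact hcontra 49 (by omega) h1 hnoT1

end Summit.ValiantsHypothesis.ValiantsHypothesis.Theorems.LacunarySymmetroidMatrixDescartes.FiniteSector
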